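import Summits.QuantumFields.YangMills.Theorems.BalabanUVNodesN15KingModelCurvaturePlaquette
import HarnessLib

/-!
# BalabanUVNodes ∕ N15 — THE KING-MODEL RUNG (PART Ϳ-l): LOCAL CURVATURE, LOCAL MASS — a SITE-DEPENDENT plaquette bound `Re⟪u,P_U(x,ν₀,ν₁)u⟫ ≤ γ(x)‖u‖²` yields a SITE-DEPENDENT
# mass potential `V(y) = (c∕2)·Σ_{P∋y}λ(γ_P) ≥ 0`: `Re⟨v,(−cΔ_U+m²)v⟩ ≥ Σ_y(m² + V(y))‖v_y‖²` (any fibre, any unitary `U`); curvature in two DISJOINT planes gives ADDITIVE masses; and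
# the honest continuum scaling: at `c = η⁻²`, plaquette angle `Bη²`, the curvature mass is `≤ B²η²∕8 → 0`
# (Track A, DAG node N15 = NE2; FAN-OUT v1.1 §N15 s3 «KING-MODEL RUNG … + what the curved case adds»; count-neutral)

HONEST FRAMING.  Count-neutral (cell `pub-ymgap`, seat `pub-ymgap-dag-n15-e` g46; `--supports stmt-QuantumFields-27247 --as helper` = K3ᴬ, KEY MAP v3).  King's fine covariance layer
`−cΔ_U+m²` (Ͱ-a `covLapF`) on ONE finite torus; elementary; NOT Bałaban's `G_k(U)`; NOT [Balaban1985BackgroundPropagators] (3.42); NOT a node discharge (N15 of record untouched); nothing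
continuum ∕ ℝ⁴ ∕ OS ∕ Clay.  §3 is the HONEST SCOPE of PART Ϳ as a theorem: in Bałaban's regular regime (bounded physical field strength `B`, spacing `η → 0`) the plaquette mass of PART Ϳ
VANISHES like `B²η²` — PART Ϳ is about lattice-scale curvature, not about the continuum limit.

THE RESULTS (`K` any period vector, `c ≥ 0`, fibre `𝕜ⁿ`, unitary `U`, `ν₀ ≠ ν₁`; `λ = plaqGap`):
* §1 `sum_plaqE_ge_local` (`Σ_x λ(γ x)·(corner masses at x) ≤ Σ_x plaqE(x,ν₀,ν₁)` under the site-dependent bound), `curvPot` (`V(y) = λ(γ(y)) + λ(γ(y−e₀)) + λ(γ(y−e₁)) + λ(γ(y−e₀−e₁))`, the four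
  `(ν₀,ν₁)`-plaquettes through `y`), `sum_corner_mass_local` (resummation corner ↦ site), `curvPot_nonneg` (`γ ≤ 1`), ★★★ **`re_quadForm_covLapF_ge_local`** —
  `Σ_y (m² + (c∕2)·V(y))·‖v_y‖² ≤ Re⟨v,(−cΔ_U+m²)v⟩`: LOCAL CURVATURE IS A LOCAL MASS POTENTIAL; `re_quadForm_covLapF_ge_local_const` (constant `γ` recovers Ϳ-b's `m² + 2cλ(γ)`, as `V ≡ 4λ`);
* §2 ★★ **`re_quadForm_covLapF_ge_two_planes`** — for pairwise distinct `ν₀,ν₁,ν₂,ν₃` (`d ≥ 3`) with plaquette bounds `γ₁` on `(ν₀,ν₁)` and `γ₂` on `(ν₂,ν₃)`: mass `m² + 2cλ(γ₁) + 2cλ(γ₂)` — curvature in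
  disjoint planes ADDS (the bond sets are disjoint; e.g. `F_{01}` and `F_{23}` both non-zero in four dimensions);
* §3 `curvatureMass_scaling_le` — `2η⁻²·(2−2cos(Bη²∕4)) ≤ B²η²∕8` (`η > 0`): the honest continuum scaling of the constant-flux mass of Ϳ-c.
PRIOR TREE ART (by name, not restated): Ϳ-a (`plaqGap`, `plaqGap_nonneg`), Ϳ-b (`bondE`, `plaqE`, `plaqE_ge`, `sum_plaqE_eq`, `bondE_nonneg`, `re_quadForm_covLapF_eq_bondE`), Ͱ-a (`covLapF`), Ͱ-b (`fib`), Ͻ-q (`kingPlaq`),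
Mathlib (`Real.one_sub_sq_div_two_le_cos`).  Dedup (rg at filing): basename 0 files; needles `curvPot|re_quadForm_covLapF_ge_local|re_quadForm_covLapF_ge_two_planes|curvatureMass_scaling_le` 0 tree files.
Locators: [DodziukMathai2006] §1 Cor 1.3; [King1986] (2.12) p.653, (4.4) p.670; [Balaban1985BackgroundPropagators] (3.23) p.394, (3.35)–(3.37) p.397 (the regular regime, contrast only).  0 `sorry`, 1 `def`.
-/

noncomputable section
open scoped BigOperators ComplexConjugate ComplexOrder InnerProductSpace
open Finset Matrix WithLp

namespace Summit.QuantumFields.YangMills.BalabanUVNodes.N15KingModelRung.Curvature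

open Literature.MathematicalPhysics.QuantumFieldTheory.Balaban1983to89.B5Prop11Plancherel (Tor unitVec)
open Summit.QuantumFields.YangMills.BalabanUVNodes.N15KingModelRung.Covariant (covLapF fib)
open Summit.QuantumFields.YangMills.BalabanUVNodes.N15KingModelRung.Cover (kingPlaq)

variable {d : ℕ} (K : Fin (d + 1) → ℕ) [hK : ∀ μ, NeZero (K μ)]
variable {𝕜 : Type*} [RCLike 𝕜] {n : Type*} [Fintype n] [DecidableEq n] {c : ℝ}

/-! ## §1 A site-dependent plaquette bound gives a site-dependent mass -/

section Local

/-- THE WEIGHTED PLAQUETTE SUM: under a site-dependent bound `γ(x)` on the `(ν₀,ν₁)`-plaquette at `x`, `Σ_x λ(γ x)·(‖v_x‖²+‖v_{x+e₀}‖²+‖v_{x+e₀+e₁}‖²+‖v_{x+e₁}‖²) ≤ Σ_x plaqE(x,ν₀,ν₁)`.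
[cite: DodziukMathai2006, Cor 1.3 §1; King1986, (2.12) p.653] -/
theorem sum_plaqE_ge_local {U : Tor K × Fin (d + 1) → Matrix n n 𝕜} (hU : ∀ b, U b ∈ Matrix.unitaryGroup n 𝕜) (v : Tor K × n → 𝕜) (ν₀ ν₁ : Fin (d + 1)) {γ : Tor K → ℝ}
    (hγ : ∀ x, ∀ u : EuclideanSpace 𝕜 n, RCLike.re ⟪u, Matrix.toEuclideanLin (kingPlaq K U x ν₀ ν₁) u⟫_𝕜 ≤ γ x * ‖u‖ ^ 2) :
    ∑ x, plaqGap (γ x) * (‖fib K v x‖ ^ 2 + ‖fib K v (x + unitVec K ν₀)‖ ^ 2 + ‖fib K v (x + unitVec K ν₀ + unitVec K ν₁)‖ ^ 2 + ‖fib K v (x + unitVec K ν₁)‖ ^ 2)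
      ≤ ∑ x, plaqE K U v x ν₀ ν₁ :=
  Finset.sum_le_sum fun x _ => plaqE_ge K hU v x ν₀ ν₁ (hγ x)

/-- THE CURVATURE POTENTIAL at `y`: the gaps of the four `(ν₀,ν₁)`-plaquettes having `y` as a corner, `V(y) = λ(γ(y)) + λ(γ(y−e₀)) + λ(γ(y−e₀−e₁)) + λ(γ(y−e₁))`.
[cite: DodziukMathai2006, Cor 1.3 §1] -/
def curvPot (ν₀ ν₁ : Fin (d + 1)) (γ : Tor K → ℝ) (y : Tor K) : ℝ :=
  plaqGap (γ y) + plaqGap (γ (y - unitVec K ν₀)) + plaqGap (γ (y - unitVec K ν₀ - unitVec K ν₁)) + plaqGap (γ (y - unitVec K ν₁))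

omit [DecidableEq n] in
/-- Resummation corner ↦ site: `Σ_x λ(γ x)·(corner masses at x) = Σ_y V(y)·‖v_y‖²`. [folklore] -/
theorem sum_corner_mass_local (v : Tor K × n → 𝕜) (ν₀ ν₁ : Fin (d + 1)) (γ : Tor K → ℝ) :
    ∑ x, plaqGap (γ x) * (‖fib K v x‖ ^ 2 + ‖fib K v (x + unitVec K ν₀)‖ ^ 2 + ‖fib K v (x + unitVec K ν₀ + unitVec K ν₁)‖ ^ 2 + ‖fib K v (x + unitVec K ν₁)‖ ^ 2)
      = ∑ y, curvPot K ν₀ ν₁ γ y * ‖fib K v y‖ ^ 2 := by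
  simp only [mul_add, Finset.sum_add_distrib, curvPot, add_mul]
  have h1 : ∑ x, plaqGap (γ x) * ‖fib K v (x + unitVec K ν₀)‖ ^ 2 = ∑ y, plaqGap (γ (y - unitVec K ν₀)) * ‖fib K v y‖ ^ 2 :=
    Fintype.sum_equiv (Equiv.addRight (unitVec K ν₀)) _ _ fun x => by simp only [Equiv.coe_addRight, add_sub_cancel_right]
  have h2 : ∑ x, plaqGap (γ x) * ‖fib K v (x + unitVec K ν₀ + unitVec K ν₁)‖ ^ 2 = ∑ y, plaqGap (γ (y - unitVec K ν₀ - unitVec K ν₁)) * ‖fib K v y‖ ^ 2 :=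
    Fintype.sum_equiv (Equiv.addRight (unitVec K ν₀ + unitVec K ν₁)) _ _ fun x => by
      simp only [Equiv.coe_addRight]
      rw [show x + (unitVec K ν₀ + unitVec K ν₁) - unitVec K ν₀ - unitVec K ν₁ = x by abel, ← add_assoc]
  have h3 : ∑ x, plaqGap (γ x) * ‖fib K v (x + unitVec K ν₁)‖ ^ 2 = ∑ y, plaqGap (γ (y - unitVec K ν₁)) * ‖fib K v y‖ ^ 2 :=
    Fintype.sum_equiv (Equiv.addRight (unitVec K ν₁)) _ _ fun x => by simp only [Equiv.coe_addRight, add_sub_cancel_right]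
  rw [h1, h2, h3]

omit hK in
/-- `V ≥ 0` when all `γ(x) ≤ 1` (unitary holonomies). [folklore] -/
theorem curvPot_nonneg [∀ μ, NeZero (K μ)] {ν₀ ν₁ : Fin (d + 1)} {γ : Tor K → ℝ} (hγ1 : ∀ x, γ x ≤ 1) (y : Tor K) : 0 ≤ curvPot K ν₀ ν₁ γ y := by
  unfold curvPot
  have := plaqGap_nonneg (hγ1 y); have := plaqGap_nonneg (hγ1 (y - unitVec K ν₀)); have := plaqGap_nonneg (hγ1 (y - unitVec K ν₀ - unitVec K ν₁)); have := plaqGap_nonneg (hγ1 (y - unitVec K ν₁))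
  positivity

/-- ★★★ **LOCAL CURVATURE IS A LOCAL MASS POTENTIAL**: for `c ≥ 0`, unitary `U`, `ν₀ ≠ ν₁` and a SITE-DEPENDENT plaquette bound `Re⟪u,P_U(x,ν₀,ν₁)u⟫ ≤ γ(x)‖u‖²`:
`Σ_y (m² + (c∕2)·V(y))·‖v_y‖² ≤ Re⟨v, (−cΔ_U+m²)v⟩`, `V = curvPot` — every site acquires a mass from the curvature of the plaquettes through it (inhomogeneous, possibly vanishing where the
field is flat). [cite: DodziukMathai2006, Cor 1.3 §1; Balaban1985BackgroundPropagators, (3.23) p.394; King1986, (4.4) p.670] -/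
theorem re_quadForm_covLapF_ge_local (hc : 0 ≤ c) (m2 : ℝ) {U : Tor K × Fin (d + 1) → Matrix n n 𝕜} (hU : ∀ b, U b ∈ Matrix.unitaryGroup n 𝕜) {ν₀ ν₁ : Fin (d + 1)} (hν : ν₀ ≠ ν₁)
    {γ : Tor K → ℝ} (hγ : ∀ x, ∀ u : EuclideanSpace 𝕜 n, RCLike.re ⟪u, Matrix.toEuclideanLin (kingPlaq K U x ν₀ ν₁) u⟫_𝕜 ≤ γ x * ‖u‖ ^ 2) (v : Tor K × n → 𝕜) :
    ∑ y, (m2 + c / 2 * curvPot K ν₀ ν₁ γ y) * ‖fib K v y‖ ^ 2 ≤ RCLike.re (star v ⬝ᵥ (covLapF K c m2 U *ᵥ v)) := by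
  rw [re_quadForm_covLapF_eq_bondE K c m2 hU v]
  have hdrop : ∑ x, bondE K U v x ν₀ + ∑ x, bondE K U v x ν₁ ≤ ∑ x, ∑ μ, bondE K U v x μ := by
    rw [← Finset.sum_add_distrib]
    refine Finset.sum_le_sum fun x _ => ?_
    rw [← Finset.sum_pair hν]
    exact Finset.sum_le_sum_of_subset_of_nonneg (Finset.subset_univ _) fun μ _ _ => bondE_nonneg K U v x μ
  have hpl := sum_plaqE_ge_local K hU v ν₀ ν₁ hγ
  rw [sum_corner_mass_local, sum_plaqE_eq] at hpl
  have hsplit : ∑ y, (m2 + c / 2 * curvPot K ν₀ ν₁ γ y) * ‖fib K v y‖ ^ 2 = m2 * ∑ y, ‖fib K v y‖ ^ 2 + c / 2 * ∑ y, curvPot K ν₀ ν₁ γ y * ‖fib K v y‖ ^ 2 := by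
    rw [Finset.mul_sum, Finset.mul_sum, ← Finset.sum_add_distrib]
    exact Finset.sum_congr rfl fun y _ => by ring
  rw [hsplit]
  have h3 : c / 2 * ∑ y, curvPot K ν₀ ν₁ γ y * ‖fib K v y‖ ^ 2 ≤ c * ∑ x, ∑ μ, bondE K U v x μ := by
    have : c / 2 * ∑ y, curvPot K ν₀ ν₁ γ y * ‖fib K v y‖ ^ 2 ≤ c / 2 * (2 * ∑ x, bondE K U v x ν₀ + 2 * ∑ x, bondE K U v x ν₁) :=
      mul_le_mul_of_nonneg_left hpl (by positivity)
    nlinarith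
  linarith

/-- A constant bound `γ` gives `V ≡ 4λ(γ)` and recovers Ϳ-b's `m² + 2c·λ(γ)`. [folklore] -/
theorem re_quadForm_covLapF_ge_local_const (hc : 0 ≤ c) (m2 : ℝ) {U : Tor K × Fin (d + 1) → Matrix n n 𝕜} (hU : ∀ b, U b ∈ Matrix.unitaryGroup n 𝕜) {ν₀ ν₁ : Fin (d + 1)}
    (hν : ν₀ ≠ ν₁) {γ : ℝ} (hγ : ∀ x, ∀ u : EuclideanSpace 𝕜 n, RCLike.re ⟪u, Matrix.toEuclideanLin (kingPlaq K U x ν₀ ν₁) u⟫_𝕜 ≤ γ * ‖u‖ ^ 2) (v : Tor K × n → 𝕜) :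
    (m2 + 2 * c * plaqGap γ) * ∑ y, ‖fib K v y‖ ^ 2 ≤ RCLike.re (star v ⬝ᵥ (covLapF K c m2 U *ᵥ v)) := by
  have h := re_quadForm_covLapF_ge_local K hc m2 hU hν (γ := fun _ => γ) hγ v
  have hV : ∀ y, curvPot K ν₀ ν₁ (fun _ => γ) y = 4 * plaqGap γ := fun y => by unfold curvPot; ring
  simp only [hV] at h
  rw [← Finset.mul_sum] at h
  calc (m2 + 2 * c * plaqGap γ) * ∑ y, ‖fib K v y‖ ^ 2 = (m2 + c / 2 * (4 * plaqGap γ)) * ∑ y, ‖fib K v y‖ ^ 2 := by ring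
    _ ≤ _ := h

end Local

/-! ## §2 Curvature in two disjoint planes adds -/

section TwoPlanes

/-- ★★ **TWO DISJOINT PLANES ADD**: for pairwise distinct directions `ν₀, ν₁, ν₂, ν₃` and plaquette bounds `γ₁` on `(ν₀,ν₁)`, `γ₂` on `(ν₂,ν₃)`:
`(m² + 2cλ(γ₁) + 2cλ(γ₂))·Σ‖v_x‖² ≤ Re⟨v,(−cΔ_U+m²)v⟩` (the two orientations use disjoint sets of bonds). [cite: DodziukMathai2006, Cor 1.3 §1; King1986, (2.12) p.653, (4.4) p.670] -/
theorem re_quadForm_covLapF_ge_two_planes (hc : 0 ≤ c) (m2 : ℝ) {U : Tor K × Fin (d + 1) → Matrix n n 𝕜} (hU : ∀ b, U b ∈ Matrix.unitaryGroup n 𝕜) {ν₀ ν₁ ν₂ ν₃ : Fin (d + 1)}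
    (h01 : ν₀ ≠ ν₁) (h02 : ν₀ ≠ ν₂) (h03 : ν₀ ≠ ν₃) (h12 : ν₁ ≠ ν₂) (h13 : ν₁ ≠ ν₃) (h23 : ν₂ ≠ ν₃) {γ₁ γ₂ : ℝ}
    (hγ₁ : ∀ x, ∀ u : EuclideanSpace 𝕜 n, RCLike.re ⟪u, Matrix.toEuclideanLin (kingPlaq K U x ν₀ ν₁) u⟫_𝕜 ≤ γ₁ * ‖u‖ ^ 2)
    (hγ₂ : ∀ x, ∀ u : EuclideanSpace 𝕜 n, RCLike.re ⟪u, Matrix.toEuclideanLin (kingPlaq K U x ν₂ ν₃) u⟫_𝕜 ≤ γ₂ * ‖u‖ ^ 2) (v : Tor K × n → 𝕜) :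
    (m2 + 2 * c * plaqGap γ₁ + 2 * c * plaqGap γ₂) * ∑ x, ‖fib K v x‖ ^ 2 ≤ RCLike.re (star v ⬝ᵥ (covLapF K c m2 U *ᵥ v)) := by
  rw [re_quadForm_covLapF_eq_bondE K c m2 hU v]
  set E : Fin (d + 1) → ℝ := fun μ => ∑ x, bondE K U v x μ with hE
  set N : ℝ := ∑ x, ‖fib K v x‖ ^ 2 with hN
  have hswap : ∑ x, ∑ μ, bondE K U v x μ = ∑ μ, E μ := by rw [hE]; exact Finset.sum_comm
  -- the four directions form a 4-element subset
  have hdrop : E ν₀ + E ν₁ + (E ν₂ + E ν₃) ≤ ∑ μ, E μ := by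
    have hE0 : ∀ μ, 0 ≤ E μ := fun μ => Finset.sum_nonneg fun x _ => bondE_nonneg K U v x μ
    have hS : ({ν₀, ν₁, ν₂, ν₃} : Finset (Fin (d + 1))) ⊆ Finset.univ := Finset.subset_univ _
    have hsum : ∑ μ ∈ ({ν₀, ν₁, ν₂, ν₃} : Finset (Fin (d + 1))), E μ = E ν₀ + E ν₁ + (E ν₂ + E ν₃) := by
      rw [Finset.sum_insert (by simp [h01, h02, h03]), Finset.sum_insert (by simp [h12, h13]), Finset.sum_pair h23]; ring
    rw [← hsum]
    exact Finset.sum_le_sum_of_subset_of_nonneg hS fun μ _ _ => hE0 μ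
  have h1 := sum_plaqE_ge K hU v ν₀ ν₁ hγ₁
  have h2 := sum_plaqE_ge K hU v ν₂ ν₃ hγ₂
  rw [sum_plaqE_eq] at h1 h2
  have h1' : 2 * plaqGap γ₁ * N ≤ E ν₀ + E ν₁ := by rw [hE, hN]; linarith
  have h2' : 2 * plaqGap γ₂ * N ≤ E ν₂ + E ν₃ := by rw [hE, hN]; linarith
  rw [hswap]
  have h3 : c * (2 * plaqGap γ₁ * N + 2 * plaqGap γ₂ * N) ≤ c * ∑ μ, E μ := mul_le_mul_of_nonneg_left (by linarith) hc
  show (m2 + 2 * c * plaqGap γ₁ + 2 * c * plaqGap γ₂) * N ≤ m2 * N + c * ∑ μ, E μ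
  linarith

end TwoPlanes

/-! ## §3 Honest continuum scaling of the constant-flux mass -/

section Scaling

omit hK in
/-- THE HONEST SCALING: with `c = η⁻²` and plaquette angle `θ = Bη²` (a FIXED physical field strength `B` on an `η`-lattice), the curvature mass of Ϳ-c obeys
`2η⁻²·(2 − 2cos(Bη²∕4)) ≤ B²η²∕8` — it VANISHES as `η → 0`: PART Ϳ is a lattice-scale effect, silent in Bałaban's regular regime ([Balaban1985BackgroundPropagators] (3.35)–(3.37)). [folklore] -/
theorem curvatureMass_scaling_le {η B : ℝ} (hη : 0 < η) : 2 * η⁻¹ ^ 2 * (2 - 2 * Real.cos (B * η ^ 2 / 4)) ≤ B ^ 2 * η ^ 2 / 8 := by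
  have hcos := Real.one_sub_sq_div_two_le_cos (x := B * η ^ 2 / 4)
  have h1 : 2 - 2 * Real.cos (B * η ^ 2 / 4) ≤ (B * η ^ 2 / 4) ^ 2 := by nlinarith
  have hη2 : 0 < η⁻¹ ^ 2 := by positivity
  calc 2 * η⁻¹ ^ 2 * (2 - 2 * Real.cos (B * η ^ 2 / 4)) ≤ 2 * η⁻¹ ^ 2 * (B * η ^ 2 / 4) ^ 2 := mul_le_mul_of_nonneg_left h1 (by positivity)
    _ = B ^ 2 * η ^ 2 / 8 := by field_simp; ring

end Scaling

end Summit.QuantumFields.YangMills.BalabanUVNodes.N15KingModelRung.Curvature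

end
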